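/-
Copyright (c) 2026. All rights reserved.
Released under Apache 2.0 license as described in the file LICENSE.
-/
import Summits.HubbardSuperconductivity.HubbardLadder.HubbardNeelFloorRows
import HarnessLib

/-!
# R2 rows (certificate-free): the antiferromagnetic SIGN STRUCTURE of the spin correlations and
# `S(q) ≤ S(π,π)` for the half-filled `4 × 4` Hubbard torus, every `U > 0`

HONEST FRAMING: ladder R1–R4 with certified numbers; no claim on H/H₀.
Cell `pub-hubbard`, seat r2 (observable brackets), device D8 (LADDER.md §R2), R2-TABLE §B rows B1/B2
(qualitative columns: sign of `C(r)`, `argmax_q S(q)`).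

Objects (OBSERVABLES.md §3–4; conventions of Hirsch PRB 31 (1985) 4403 eq. (4.7) and Qin–Shi–Zhang
PRB 94 (2016) 085103 §IV): for a ground state `ψ` of `H(t = 1, U)` on the `4 × 4` torus in the
half-filled sector `N = 16`: the spin correlation `⟨ψ, 𝐒_x·𝐒_y ψ⟩` (all three components), the spin
structure operator at momentum `q ∈ (2π/4)·{0,1,2,3}²`,
`𝓢(q) = Σ_{x,y} e^{iq·(x-y)} 𝐒_x·𝐒_y` (`spinStructureFour q`; `⟨ψ, 𝓢(q) ψ⟩ = 16 · S(q)` in a unit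
vector, `S(q) = (1/N) Σ_{x,y} e^{iq(x-y)} ⟨𝐒_x·𝐒_y⟩`), and the staggered one `𝓢 = 𝓢(π,π) =
stagStructureFour` (`spinStructureFour_pi_pi`).

## Method (kernel only; NO certificate, no numerics, 0 core-h)

KERNEL (tree, `Literature/…/HubbardSpinReflectionSignRule`: Lieb's spin-reflection positivity ⇒ the
Shen–Qiu–Tian sign rule + SU(2) isotropy on THE (unique, singlet) half-filled ground state):
`ε_x ε_y ⟨ψ, 𝐒_x·𝐒_y ψ⟩ ≥ 0` and `|⟨ψ, (Σ a_x b_y 𝐒_x·𝐒_y) ψ⟩| ≤ ⟨ψ, 𝓢 ψ⟩` for `|a|, |b| ≤ 1`.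
Rows, valid for EVERY `U > 0` and every ground state `ψ` of the `N = 16` sector (no energy input):
* `stagSign_spinDot_four_nonneg`: `(-1)^{x₁+x₂+y₁+y₂} Re ⟨ψ, 𝐒_x·𝐒_y ψ⟩ ≥ 0` for all `256` pairs;
* `re_expect_fermionSpinDot_four_nonpos_of_adj`: every BOND correlation is `≤ 0` (AF sign of `C(1,0)`);
* `norm_expect_spinStructureFour_le`: `|⟨ψ, 𝓢(q) ψ⟩| ≤ Re ⟨ψ, 𝓢 ψ⟩` for all `16` momenta `q`, i.e.
  **`|S(q)| ≤ S(π,π)`: the spin structure factor of the half-filled ground state peaks at `(π,π)`.**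
Comparators (uncertified, context only): the AF sign of the TL nearest-neighbour correlation is
certified numerically at `U = 4, 6, 8, 12` in pub-mbboot `certs/sdp1/CORRELATORS.md` (R2-TABLE §B4,
INHERITED); QMC structure factors of the half-filled model peak at `(π,π)` (Hirsch 1985 Fig. 13;
Varney et al. 2009). Limits, honestly: finite volume, `t′ = 0`, `n = 1` only; a sign is not a number —
these rows carry no width and say nothing about long-range order or H/H₀.

## References
* S.-Q. Shen, Z.-M. Qiu, G.-S. Tian, Phys. Rev. Lett. 72 (1994) 1280. [cite: ShenQiuTian1994, Theorem and eqs. (7)–(9)]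
* G.-S. Tian, J. Stat. Phys. 116 (2004) 629, §3. [cite: Tian2004, §3]
* E. H. Lieb, Phys. Rev. Lett. 62 (1989) 1201, Theorem 2. [cite: LiebPRL1989, Theorem 2]
* J. E. Hirsch, Phys. Rev. B 31 (1985) 4403, eq. (4.7). [cite: HirschPRB1985, eq. (4.7)]
-/

noncomputable section

namespace Summit.HubbardSuperconductivity.HubbardLadder

open Literature.MathematicalPhysics.QuantumLattice Literature.Probability.LatticeModels
open FermionSpinMoment Matrix

/-! ### The sign structure of all `256` spin correlations -/

/-- **Shen–Qiu–Tian sign structure (isotropic form) on the `4 × 4` torus**: for every ground state `ψ`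
of `H(1, U)`, `U > 0`, in the sector `N = 16` and all sites `x, y`,
`(-1)^{x₁+x₂} (-1)^{y₁+y₂} Re ⟨ψ, 𝐒_x·𝐒_y ψ⟩ ≥ 0`. [cite: ShenQiuTian1994, Theorem and eqs. (7)–(9)] -/
theorem stagSign_spinDot_four_nonneg {U : ℝ} (hU : 0 < U) {ψ : Fock (Orb (FermionTorus 2 4))}
    (hψ : IsGroundState (hamiltonian (fermionTorusGraph 2 4) 1 U) 16 ψ) (x y : FermionTorus 2 4) :
    0 ≤ ((-1 : ℂ) ^ ((ofLex x 0).val + (ofLex x 1).val) * (-1 : ℂ) ^ ((ofLex y 0).val + (ofLex y 1).val) *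
      expect (fermionSpinDot x y) ψ).re := by
  have hψ' : IsGroundState (hamiltonian (fermionTorusGraph 2 4) 1 U) (4 ^ 2) ψ := by simpa using hψ
  obtain ⟨hG, hA, h2, -⟩ := LiebHalfFilled.hubbardTorus_lieb_hypotheses (L := 4) (by decide)
  have hcard := LiebHalfFilled.compl_card_eq_card_of_two_mul h2
  have h16 : Fintype.card (FermionTorus 2 4) = 4 ^ 2 := rfl
  have h := stagSign_mul_expect_fermionSpinDot_nonneg hG _ hA hcard one_ne_zero hU
    (h16 ▸ hψ'.1) (h16 ▸ hψ'.2.2) x y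
  rw [← evenSitesFour_eq_filter_torusStagger, stagSign_evenSitesFour, stagSign_evenSitesFour] at h
  exact (Complex.nonneg_iff.mp h).1

/-- **Every bond correlation of the half-filled `4 × 4` ground state is antiferromagnetic**:
`x ∼ y ⇒ Re ⟨ψ, 𝐒_x·𝐒_y ψ⟩ ≤ 0`, every `U > 0`. [cite: ShenQiuTian1994, Theorem and eqs. (7)–(9)] -/
theorem re_expect_fermionSpinDot_four_nonpos_of_adj {U : ℝ} (hU : 0 < U)
    {ψ : Fock (Orb (FermionTorus 2 4))} (hψ : IsGroundState (hamiltonian (fermionTorusGraph 2 4) 1 U) 16 ψ)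
    {x y : FermionTorus 2 4} (hxy : (fermionTorusGraph 2 4).Adj x y) :
    (expect (fermionSpinDot x y) ψ).re ≤ 0 := by
  have hψ' : IsGroundState (hamiltonian (fermionTorusGraph 2 4) 1 U) (4 ^ 2) ψ := by simpa using hψ
  exact hubbardTorus_re_expect_fermionSpinDot_nonpos_of_adj (L := 4) (by decide) one_ne_zero hU
    hψ'.1 hψ'.2.2 hxy

/-- **Same-sublattice correlations are ferromagnetic in sign**: `x₁+x₂ ≡ y₁+y₂ (mod 2) ⇒
Re ⟨ψ, 𝐒_x·𝐒_y ψ⟩ ≥ 0` (e.g. the diagonal neighbour `C(1,1) ≥ 0`), every `U > 0`.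
[cite: ShenQiuTian1994, Theorem and eqs. (7)–(9)] -/
theorem re_expect_fermionSpinDot_four_nonneg_of_even {U : ℝ} (hU : 0 < U)
    {ψ : Fock (Orb (FermionTorus 2 4))} (hψ : IsGroundState (hamiltonian (fermionTorusGraph 2 4) 1 U) 16 ψ)
    {x y : FermionTorus 2 4}
    (hxy : Even ((ofLex x 0).val + (ofLex x 1).val + ((ofLex y 0).val + (ofLex y 1).val))) :
    0 ≤ (expect (fermionSpinDot x y) ψ).re := by
  have h := stagSign_spinDot_four_nonneg hU hψ x y
  rwa [← pow_add, hxy.neg_one_pow, one_mul] at h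

/-- **Opposite-sublattice correlations are antiferromagnetic in sign**: `x₁+x₂+y₁+y₂` odd ⇒
`Re ⟨ψ, 𝐒_x·𝐒_y ψ⟩ ≤ 0`, every `U > 0`. [cite: ShenQiuTian1994, Theorem and eqs. (7)–(9)] -/
theorem re_expect_fermionSpinDot_four_nonpos_of_odd {U : ℝ} (hU : 0 < U)
    {ψ : Fock (Orb (FermionTorus 2 4))} (hψ : IsGroundState (hamiltonian (fermionTorusGraph 2 4) 1 U) 16 ψ)
    {x y : FermionTorus 2 4}
    (hxy : Odd ((ofLex x 0).val + (ofLex x 1).val + ((ofLex y 0).val + (ofLex y 1).val))) :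
    (expect (fermionSpinDot x y) ψ).re ≤ 0 := by
  have h := stagSign_spinDot_four_nonneg hU hψ x y
  rw [← pow_add, hxy.neg_one_pow, neg_one_mul, Complex.neg_re] at h
  linarith

/-! ### The spin structure factor peaks at `(π,π)` -/

/-- The Bloch phase `e^{i q·x}`, `q = (2π/4)(q₁, q₂)`, on the `4 × 4` torus. [cite: HirschPRB1985, eq. (4.7)] -/
def blochPhaseFour (q x : FermionTorus 2 4) : ℂ :=
  Complex.exp ((2 * Real.pi *
    (((ofLex q 0).val * (ofLex x 0).val + (ofLex q 1).val * (ofLex x 1).val : ℕ) : ℝ) / 4 : ℝ) * Complex.I)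

/-- `|e^{iq·x}| = 1`. [cite: HirschPRB1985, eq. (4.7)] -/
theorem norm_blochPhaseFour (q x : FermionTorus 2 4) : ‖blochPhaseFour q x‖ = 1 :=
  Complex.norm_exp_ofReal_mul_I _

/-- **The spin structure operator at momentum `q`**: `𝓢(q) = Σ_{x,y} e^{iq·x} e^{-iq·y} 𝐒_x·𝐒_y`
(`⟨ψ, 𝓢(q) ψ⟩ = 16 · S(q)` in a unit vector). [cite: HirschPRB1985, eq. (4.7)] -/
def spinStructureFour (q : FermionTorus 2 4) :
    Matrix (Finset (Orb (FermionTorus 2 4))) (Finset (Orb (FermionTorus 2 4))) ℂ :=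
  ∑ x, ∑ y, (blochPhaseFour q x * star (blochPhaseFour q y)) • fermionSpinDot x y

/-- **`|S(q)| ≤ S(π,π)` for every momentum, every `U > 0`**: for every ground state `ψ` of `H(1, U)`
in the sector `N = 16` and every `q`, `|⟨ψ, 𝓢(q) ψ⟩| ≤ Re ⟨ψ, 𝓢 ψ⟩` — the spin structure factor of
the half-filled ground state is maximal at the antiferromagnetic wave vector (no certificate).
[cite: ShenQiuTian1994, Theorem and eqs. (7)–(9)] -/
theorem norm_expect_spinStructureFour_le {U : ℝ} (hU : 0 < U) {ψ : Fock (Orb (FermionTorus 2 4))}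
    (hψ : IsGroundState (hamiltonian (fermionTorusGraph 2 4) 1 U) 16 ψ) (q : FermionTorus 2 4) :
    ‖expect (spinStructureFour q) ψ‖ ≤ (expect stagStructureFour ψ).re := by
  have hψ' : IsGroundState (hamiltonian (fermionTorusGraph 2 4) 1 U) (4 ^ 2) ψ := by simpa using hψ
  have h := hubbardTorus_norm_expect_modulated_spinDot_le_stagSpinStructure (L := 4) (by decide)
    one_ne_zero hU hψ'.1 hψ'.2.2 (blochPhaseFour q) (fun y => star (blochPhaseFour q y))
    (fun x => (norm_blochPhaseFour q x).le) (fun y => by rw [norm_star]; exact (norm_blochPhaseFour q y).le)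
  rw [stagStructureFour_eq_stagSpinStructure_torusStagger]
  exact h

/-- `e^{iπ(x₁+x₂)} = (-1)^{x₁+x₂}`: the Bloch phase at `q = (π,π)` (index `(2,2)`) is the staggered
sign. [cite: HirschPRB1985, eq. (4.7)] -/
theorem blochPhaseFour_two_two (x : FermionTorus 2 4) :
    blochPhaseFour (toLex ![2, 2]) x = (-1 : ℂ) ^ ((ofLex x 0).val + (ofLex x 1).val) := by
  rw [← Complex.exp_pi_mul_I, ← Complex.exp_nat_mul]
  unfold blochPhaseFour
  congr 1
  have h2 : (ofLex (toLex ![(2 : Fin 4), 2]) 0).val = 2 ∧ (ofLex (toLex ![(2 : Fin 4), 2]) 1).val = 2 :=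
    ⟨rfl, rfl⟩
  rw [h2.1, h2.2]
  push_cast
  ring

/-- **`𝓢(π,π) = 𝓢`**: the spin structure operator at `q = (π,π)` is the staggered structure operator
`stagStructureFour`. [cite: HirschPRB1985, eq. (4.7)] -/
theorem spinStructureFour_pi_pi : spinStructureFour (toLex ![2, 2]) = stagStructureFour := by
  rw [spinStructureFour, stagStructureFour_eq]
  refine Finset.sum_congr rfl fun x _ => Finset.sum_congr rfl fun y _ => ?_
  rw [blochPhaseFour_two_two, blochPhaseFour_two_two, star_pow, star_neg, star_one]

end Summit.HubbardSuperconductivity.HubbardLadder
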